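import Summits.PneNP.PneNP.Theorems.ConvexRankGatesConvexGateBlindExactLiftingTrianglePairSplit
import Mathlib.Analysis.SpecialFunctions.Trigonometric.Series
import Mathlib.Analysis.MeanInequalities

/-!
# Even moments of Rademacher sums and bilinear forms; the pair tail count (lead c6, THEOREM C√ steps F1–F3)

Support file for crux `ConvexGateBlind` (stmt-PneNP-10680), line `xor-door-perfect-completeness`, open stub
`stub_exactLifting`; the ANALYTIC step of the Lean route to THEOREM C√ (memo `THEOREM-C-sqrt.md` on the item:
no-lift LP relaxations of triangle-vs-cut need `e^{Ω(√t)}` inequalities for every margin `ε`).  Everything is about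
finite sums over block colourings `y : Fin n → Bool` with signs `pm (y i) = ±1`; no measure theory.

* §1 **Khintchine, even moments, via the exponential** (`khintchine_even`): for real `a` and `k ≥ 0`,
  `Σ_y (Σ_i ±a_i)^{2k} ≤ 2^n · K_k · (Σ_i a_i²)^k` with `K_k = 2·(2k)!·e^k/(2k)^k` (`≤ 2(2k)^k`-ish; the sharp constant is
  `(2k−1)!!`).  Proof: `x^{2k} ≤ (2k)!·(e^{λx}+e^{−λx})/λ^{2k}` (`Real.pow_div_factorial_le_exp`), the sign sum factorises
  the exponential sum into `Π_i 2cosh(λa_i) ≤ 2^n e^{λ²Σa²/2}` (`Real.cosh_le_exp_half_sq`), and `λ² = 2k/Σa²`.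
* §2 **Minkowski for a finite family** (`minkowski_finset`) from Mathlib's two-term `Real.Lp_add_le`, and the
  **bilinear even-moment bound** (`bil_moment`): `Σ_{y,y'} (Σ_{a,b} ±±μ(a,b))^{2k} ≤ 4^n K_k² (Σ μ²)^k` — Khintchine in `y`
  for fixed `y'`, then Minkowski in `L^k` over `y'` and Khintchine again (this is Bonami's hypercontractive inequality
  for decoupled degree-2 Rademacher chaos, with a slightly worse constant).
* §3 **Markov ⇒ pair tail count** (`card_bigPairs_le`): `#{(y,y') : bil μ y y' > u} ≤ 4^n K_k² (Σμ²)^k / u^{2k}`.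

Nothing is cited; everything is elementary given the two Mathlib lemmas named above.
-/

set_option linter.dupNamespace false -- `Summit.PneNP.PneNP.…`: summit = sub-problem (D-0017)

namespace Summit.PneNP.PneNP.Theorems.XorDoor.TriLine.Heavy

open Finset Classical Real

noncomputable section

/-! ## §1 Khintchine's inequality for even moments -/

section Khintchine

variable {n : ℕ}

/-- a Rademacher sum indexed by a block colouring: `Σ_i ± a_i` -/
def rsum (a : Fin n → ℝ) (y : Fin n → Bool) : ℝ := ∑ i, pm (y i) * a i

/-- the Khintchine constant used here: `K_k = 2·(2k)!·e^k/(2k)^k` -/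
def Kk (k : ℕ) : ℝ := 2 * (2 * k).factorial * exp k / (2 * k) ^ k

/-- `K_k > 0` -/
lemma Kk_pos (k : ℕ) : 0 < Kk k := by
  unfold Kk
  have h1 : (0 : ℝ) < (2 * k).factorial := by exact_mod_cast Nat.factorial_pos _
  have h2 : (0 : ℝ) < (2 * k : ℝ) ^ k := by
    rcases Nat.eq_zero_or_pos k with hk | hk
    · subst hk; simp
    · positivity
  positivity

/-- the exponential sum factorises over the coordinates -/
lemma sum_exp_rsum (a : Fin n → ℝ) (l : ℝ) :
    ∑ y : Fin n → Bool, exp (l * rsum a y) = ∏ i, (exp (l * a i) + exp (-(l * a i))) := by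
  have h : ∀ y : Fin n → Bool, exp (l * rsum a y) = ∏ i, exp (l * (pm (y i) * a i)) := by
    intro y
    rw [rsum, mul_sum, exp_sum]
  simp_rw [h]
  rw [show (∑ x : Fin n → Bool, ∏ i, exp (l * (pm (x i) * a i))) = ∏ i, ∑ b : Bool, exp (l * (pm b * a i)) from
    (Fintype.prod_sum fun i (b : Bool) => exp (l * (pm b * a i))).symm]
  refine Fintype.prod_congr _ _ fun i => ?_
  simp only [Fintype.sum_bool, pm_true, pm_false, one_mul, neg_one_mul, mul_neg]

/-- `Σ_y e^{λ·rsum} ≤ 2^n e^{λ² Σa²/2}` -/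
lemma sum_exp_rsum_le (a : Fin n → ℝ) (l : ℝ) :
    ∑ y : Fin n → Bool, exp (l * rsum a y) ≤ 2 ^ n * exp (l ^ 2 * (∑ i, a i ^ 2) / 2) := by
  rw [sum_exp_rsum]
  have hfac : ∀ i, exp (l * a i) + exp (-(l * a i)) ≤ 2 * exp ((l * a i) ^ 2 / 2) := by
    intro i
    have := Real.cosh_le_exp_half_sq (l * a i)
    rw [Real.cosh_eq] at this
    linarith
  calc ∏ i, (exp (l * a i) + exp (-(l * a i))) ≤ ∏ i, (2 * exp ((l * a i) ^ 2 / 2)) := by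
        refine prod_le_prod (fun i _ => by positivity) fun i _ => hfac i
    _ = 2 ^ n * exp (l ^ 2 * (∑ i, a i ^ 2) / 2) := by
        rw [prod_mul_distrib, prod_const, card_univ, Fintype.card_fin, ← exp_sum]
        congr 1
        rw [mul_sum, sum_div]
        refine congrArg exp (sum_congr rfl fun i _ => by ring)

/-- `x^{2k} ≤ (2k)!·(e^{λx} + e^{−λx})/λ^{2k}` for `λ > 0` -/
lemma pow_le_fact_mul_exp (x : ℝ) (k : ℕ) {l : ℝ} (hl : 0 < l) :
    x ^ (2 * k) ≤ (2 * k).factorial / l ^ (2 * k) * (exp (l * x) + exp (-(l * x))) := by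
  have h0 : 0 ≤ l * |x| := mul_nonneg hl.le (abs_nonneg x)
  have h1 := Real.pow_div_factorial_le_exp (hx := h0) (n := 2 * k)
  have hfpos : (0 : ℝ) < (2 * k).factorial := by exact_mod_cast Nat.factorial_pos _
  have hlk : 0 < l ^ (2 * k) := pow_pos hl _
  have h2 : (l * |x|) ^ (2 * k) = l ^ (2 * k) * x ^ (2 * k) := by
    rw [mul_pow, pow_mul |x|, sq_abs, ← pow_mul]
  rw [h2, div_le_iff₀ hfpos] at h1
  have h3 : exp (l * |x|) ≤ exp (l * x) + exp (-(l * x)) := by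
    rcases le_or_gt 0 x with hx | hx
    · rw [abs_of_nonneg hx]; linarith [exp_pos (-(l * x))]
    · rw [abs_of_neg hx, mul_neg]; linarith [exp_pos (l * x)]
  rw [div_mul_eq_mul_div, le_div_iff₀ hlk]
  calc x ^ (2 * k) * l ^ (2 * k) = l ^ (2 * k) * x ^ (2 * k) := mul_comm _ _
    _ ≤ exp (l * |x|) * (2 * k).factorial := h1
    _ ≤ (exp (l * x) + exp (-(l * x))) * (2 * k).factorial := by gcongr
    _ = (2 * k).factorial * (exp (l * x) + exp (-(l * x))) := mul_comm _ _

/-- Khintchine with a free parameter `λ > 0` -/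
lemma khintchine_param (a : Fin n → ℝ) (k : ℕ) {l : ℝ} (hl : 0 < l) :
    ∑ y : Fin n → Bool, rsum a y ^ (2 * k)
      ≤ (2 * k).factorial / l ^ (2 * k) * (2 * 2 ^ n * exp (l ^ 2 * (∑ i, a i ^ 2) / 2)) := by
  calc ∑ y : Fin n → Bool, rsum a y ^ (2 * k)
        ≤ ∑ y : Fin n → Bool, (2 * k).factorial / l ^ (2 * k) * (exp (l * rsum a y) + exp (-(l * rsum a y))) :=
          sum_le_sum fun y _ => pow_le_fact_mul_exp _ k hl
    _ = (2 * k).factorial / l ^ (2 * k) *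
          (∑ y : Fin n → Bool, exp (l * rsum a y) + ∑ y : Fin n → Bool, exp ((-l) * rsum a y)) := by
          rw [← mul_sum, sum_add_distrib]
          congr 1; congr 1
          exact sum_congr rfl fun y _ => by ring_nf
    _ ≤ (2 * k).factorial / l ^ (2 * k) * (2 * 2 ^ n * exp (l ^ 2 * (∑ i, a i ^ 2) / 2)) := by
          have e1 := sum_exp_rsum_le a l
          have e2 := sum_exp_rsum_le a (-l)
          rw [neg_sq] at e2
          have hc : 0 ≤ (2 * k).factorial / l ^ (2 * k) := by positivity
          nlinarith

/-- **Khintchine's inequality, even moments** (constant `K_k = 2(2k)!e^k/(2k)^k`):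
`Σ_y (Σ_i ± a_i)^{2k} ≤ 2^n K_k (Σ a_i²)^k`. -/
theorem khintchine_even (a : Fin n → ℝ) (k : ℕ) :
    ∑ y : Fin n → Bool, rsum a y ^ (2 * k) ≤ 2 ^ n * Kk k * (∑ i, a i ^ 2) ^ k := by
  set B := ∑ i, a i ^ 2 with hB
  have hBnn : 0 ≤ B := sum_nonneg fun i _ => sq_nonneg _
  rcases Nat.eq_zero_or_pos k with hk | hk
  · -- `k = 0`: both sides are `2^n` and `2^n · 2`
    subst hk
    have hK : Kk 0 = 2 := by simp [Kk]
    simp only [Nat.mul_zero, pow_zero, sum_const, card_univ, nsmul_eq_mul, mul_one, hK]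
    rw [Fintype.card_fun, Fintype.card_bool, Fintype.card_fin]
    push_cast
    linarith [pow_pos (show (0 : ℝ) < 2 by norm_num) n]
  rcases hBnn.eq_or_lt with hB0 | hBpos
  · -- `B = 0`: all `a i = 0`, the sum vanishes
    have ha : ∀ i, a i = 0 := by
      intro i
      have := (sum_eq_zero_iff_of_nonneg (fun i _ => sq_nonneg (a i))).1 hB0.symm i (mem_univ i)
      exact pow_eq_zero_iff (n := 2) (by norm_num) |>.1 this
    have hr : ∀ y, rsum a y = 0 := fun y => by simp [rsum, ha]
    have hk0 : 2 * k ≠ 0 := by omega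
    simp only [hr, zero_pow hk0, sum_const_zero]
    exact mul_nonneg (mul_nonneg (by positivity) (Kk_pos k).le) (pow_nonneg hBnn k)
  -- main case: `λ² = 2k/B`
  set l := Real.sqrt (2 * k / B) with hl
  have hkpos : (0 : ℝ) < k := by exact_mod_cast hk
  have hq : 0 < 2 * (k : ℝ) / B := by positivity
  have hlpos : 0 < l := Real.sqrt_pos.2 hq
  have hl2 : l ^ 2 = 2 * k / B := Real.sq_sqrt hq.le
  have h := khintchine_param a k hlpos
  have hexp : exp (l ^ 2 * B / 2) = exp k := by
    rw [hl2]; congr 1; field_simp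
  have hlk : l ^ (2 * k) = (2 * k / B) ^ k := by rw [pow_mul, hl2]
  rw [hexp, hlk] at h
  have hid : ((2 * k).factorial : ℝ) / (2 * ↑k / B) ^ k * (2 * 2 ^ n * exp k) = 2 ^ n * Kk k * B ^ k := by
    unfold Kk
    have hBk : (0 : ℝ) < B ^ k := pow_pos hBpos k
    have h2k : (0 : ℝ) < (2 * (k : ℝ)) ^ k := by positivity
    rw [div_pow]
    field_simp
  linarith [h, hid.le, hid.ge]

end Khintchine

/-! ## §2 Minkowski for a finite family and the bilinear moment bound -/

/-- **Minkowski for a finite family of non-negative functions**: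
`(Σ_y (Σ_{a∈s} f a y)^p)^{1/p} ≤ Σ_{a∈s} (Σ_y (f a y)^p)^{1/p}` for `p ≥ 1`. -/
theorem minkowski_finset {α β : Type*} [Fintype β] (s : Finset α) (f : α → β → ℝ) (hf : ∀ a y, 0 ≤ f a y)
    {p : ℝ} (hp : 1 ≤ p) :
    (∑ y, (∑ a ∈ s, f a y) ^ p) ^ (1 / p) ≤ ∑ a ∈ s, (∑ y, f a y ^ p) ^ (1 / p) := by
  induction s using Finset.induction_on with
  | empty =>
      have hp0 : p ≠ 0 := by linarith
      simp [Real.zero_rpow hp0, Real.zero_rpow (inv_ne_zero hp0)]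
  | @insert a₀ s ha ih =>
      rw [sum_insert ha]
      have hstep := Real.Lp_add_le (univ : Finset β) (fun y => f a₀ y) (fun y => ∑ a ∈ s, f a y) hp
      have hsnn : ∀ y, 0 ≤ ∑ a ∈ s, f a y := fun y => sum_nonneg fun a _ => hf a y
      simp only [abs_of_nonneg (hf a₀ _), abs_of_nonneg (hsnn _),
        abs_of_nonneg (add_nonneg (hf a₀ _) (hsnn _))] at hstep
      have hins : ∀ y, ∑ a ∈ insert a₀ s, f a y = f a₀ y + ∑ a ∈ s, f a y := fun y => sum_insert ha
      simp_rw [hins]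
      exact hstep.trans (by linarith)

variable {t : ℕ}

/-- the bilinear form is a Rademacher sum in `y` whose coefficients are Rademacher sums in `y'` -/
lemma bil_eq_rsum (μ : Fin t → Fin t → ℝ) (y y' : Fin t → Bool) :
    bil μ y y' = rsum (fun a => rsum (μ a) y') y := by
  simp only [bil, rsum, mul_sum]
  refine sum_congr rfl fun a _ => sum_congr rfl fun b _ => by ring

/-- the quadratic moment: `Σ_{y'} (Σ_a (Σ_b ± μ_ab)²)^k ≤ 2^t K_k (Σ μ²)^k` (Minkowski + Khintchine) -/
lemma quad_moment (μ : Fin t → Fin t → ℝ) {k : ℕ} (hk : 1 ≤ k) :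
    ∑ y' : Fin t → Bool, (∑ a, rsum (μ a) y' ^ 2) ^ k ≤ 2 ^ t * Kk k * (∑ a, ∑ b, μ a b ^ 2) ^ k := by
  have hk0 : (k : ℝ) ≠ 0 := by exact_mod_cast (show k ≠ 0 by omega)
  have hkn : k ≠ 0 := by omega
  have hp : (1 : ℝ) ≤ k := by exact_mod_cast hk
  -- Minkowski with `f a y' = (rsum (μ a) y')²`, exponent `p = k`
  have hM := minkowski_finset (univ : Finset (Fin t)) (fun a (y' : Fin t → Bool) => rsum (μ a) y' ^ 2)
    (fun a y' => sq_nonneg _) hp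
  -- each summand on the right: Khintchine
  have hK : ∀ a, (∑ y' : Fin t → Bool, (rsum (μ a) y' ^ 2) ^ (k : ℝ)) ^ (1 / (k : ℝ))
      ≤ (2 ^ t * Kk k) ^ (1 / (k : ℝ)) * ∑ b, μ a b ^ 2 := by
    intro a
    have h1 : ∑ y' : Fin t → Bool, (rsum (μ a) y' ^ 2) ^ (k : ℝ) = ∑ y' : Fin t → Bool, rsum (μ a) y' ^ (2 * k) := by
      refine sum_congr rfl fun y' _ => ?_
      rw [Real.rpow_natCast, ← pow_mul]
    rw [h1]
    have h2 := khintchine_even (μ a) k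
    have hnn : 0 ≤ ∑ y' : Fin t → Bool, rsum (μ a) y' ^ (2 * k) :=
      sum_nonneg fun y' _ => by rw [pow_mul]; exact pow_nonneg (sq_nonneg _) _
    have hC : 0 ≤ 2 ^ t * Kk k := mul_nonneg (by positivity) (Kk_pos k).le
    have hBnn : 0 ≤ ∑ b, μ a b ^ 2 := sum_nonneg fun b _ => sq_nonneg _
    calc (∑ y' : Fin t → Bool, rsum (μ a) y' ^ (2 * k)) ^ (1 / (k : ℝ))
          ≤ (2 ^ t * Kk k * (∑ b, μ a b ^ 2) ^ k) ^ (1 / (k : ℝ)) :=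
            Real.rpow_le_rpow hnn h2 (by positivity)
      _ = (2 ^ t * Kk k) ^ (1 / (k : ℝ)) * ∑ b, μ a b ^ 2 := by
            rw [Real.mul_rpow hC (pow_nonneg hBnn k), one_div, Real.pow_rpow_inv_natCast hBnn hkn]
  -- combine
  have hsum : ∑ a, (∑ y' : Fin t → Bool, (rsum (μ a) y' ^ 2) ^ (k : ℝ)) ^ (1 / (k : ℝ))
      ≤ (2 ^ t * Kk k) ^ (1 / (k : ℝ)) * ∑ a, ∑ b, μ a b ^ 2 := by
    rw [mul_sum]; exact sum_le_sum fun a _ => hK a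
  have hL := hM.trans hsum
  -- undo the `1/k`-th power
  have hC : 0 ≤ 2 ^ t * Kk k := mul_nonneg (by positivity) (Kk_pos k).le
  have hF : 0 ≤ ∑ a, ∑ b, μ a b ^ 2 := sum_nonneg fun a _ => sum_nonneg fun b _ => sq_nonneg _
  have hlhs_nn : 0 ≤ ∑ y' : Fin t → Bool, (∑ a, rsum (μ a) y' ^ 2) ^ (k : ℝ) :=
    sum_nonneg fun y' _ => Real.rpow_nonneg (sum_nonneg fun a _ => sq_nonneg _) _
  have hR : ((2 ^ t * Kk k) ^ (1 / (k : ℝ)) * ∑ a, ∑ b, μ a b ^ 2) ^ k = 2 ^ t * Kk k * (∑ a, ∑ b, μ a b ^ 2) ^ k := by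
    rw [mul_pow, one_div, Real.rpow_inv_natCast_pow hC hkn]
  have key := pow_le_pow_left₀ (Real.rpow_nonneg hlhs_nn _) hL k
  rw [one_div, Real.rpow_inv_natCast_pow hlhs_nn hkn, ← one_div, hR] at key
  calc ∑ y' : Fin t → Bool, (∑ a, rsum (μ a) y' ^ 2) ^ k
      = ∑ y' : Fin t → Bool, (∑ a, rsum (μ a) y' ^ 2) ^ (k : ℝ) :=
          sum_congr rfl fun y' _ => (Real.rpow_natCast _ _).symm
    _ ≤ _ := key

/-- **Bilinear even-moment bound** (Bonami for decoupled degree-2 chaos, constant `K_k²`):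
`Σ_{y,y'} (bil μ y y')^{2k} ≤ 4^t K_k² (Σ μ²)^k`. -/
theorem bil_moment (μ : Fin t → Fin t → ℝ) {k : ℕ} (hk : 1 ≤ k) :
    ∑ y : Fin t → Bool, ∑ y' : Fin t → Bool, bil μ y y' ^ (2 * k)
      ≤ 4 ^ t * Kk k ^ 2 * (∑ a, ∑ b, μ a b ^ 2) ^ k := by
  rw [sum_comm]
  have h1 : ∀ y' : Fin t → Bool, ∑ y : Fin t → Bool, bil μ y y' ^ (2 * k)
      ≤ 2 ^ t * Kk k * (∑ a, rsum (μ a) y' ^ 2) ^ k := by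
    intro y'
    simp_rw [bil_eq_rsum]
    exact khintchine_even _ k
  calc ∑ y' : Fin t → Bool, ∑ y : Fin t → Bool, bil μ y y' ^ (2 * k)
      ≤ ∑ y' : Fin t → Bool, 2 ^ t * Kk k * (∑ a, rsum (μ a) y' ^ 2) ^ k := sum_le_sum fun y' _ => h1 y'
    _ = 2 ^ t * Kk k * ∑ y' : Fin t → Bool, (∑ a, rsum (μ a) y' ^ 2) ^ k := by rw [← mul_sum]
    _ ≤ 2 ^ t * Kk k * (2 ^ t * Kk k * (∑ a, ∑ b, μ a b ^ 2) ^ k) := by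
          have := quad_moment μ hk
          have hC : 0 ≤ 2 ^ t * Kk k := mul_nonneg (by positivity) (Kk_pos k).le
          exact mul_le_mul_of_nonneg_left this hC
    _ = 4 ^ t * Kk k ^ 2 * (∑ a, ∑ b, μ a b ^ 2) ^ k := by
          have : (4 : ℝ) ^ t = 2 ^ t * 2 ^ t := by rw [← mul_pow]; norm_num
          rw [this]; ring

/-! ## §3 The pair tail count -/

/-- **Markov ⇒ the pair tail count**: `#{(y,y') : bil μ y y' > u} · u^{2k} ≤ 4^t K_k² (Σμ²)^k` for `u > 0`, `k ≥ 1`. -/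
theorem card_bigPairs_le (μ : Fin t → Fin t → ℝ) {u : ℝ} (hu : 0 < u) {k : ℕ} (hk : 1 ≤ k) :
    (#(bigPairs μ u) : ℝ) * u ^ (2 * k) ≤ 4 ^ t * Kk k ^ 2 * (∑ a, ∑ b, μ a b ^ 2) ^ k := by
  have hmom := bil_moment μ hk
  have hsum : ∑ y : Fin t → Bool, ∑ y' : Fin t → Bool, bil μ y y' ^ (2 * k)
      = ∑ p : (Fin t → Bool) × (Fin t → Bool), bil μ p.1 p.2 ^ (2 * k) :=
    (Fintype.sum_prod_type' fun y y' => bil μ y y' ^ (2 * k)).symm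
  rw [hsum] at hmom
  have hnn : ∀ p : (Fin t → Bool) × (Fin t → Bool), 0 ≤ bil μ p.1 p.2 ^ (2 * k) := fun p => by
    rw [pow_mul]; exact pow_nonneg (sq_nonneg _) _
  have h1 : ∑ p ∈ bigPairs μ u, bil μ p.1 p.2 ^ (2 * k)
      ≤ ∑ p : (Fin t → Bool) × (Fin t → Bool), bil μ p.1 p.2 ^ (2 * k) :=
    sum_le_sum_of_subset_of_nonneg (subset_univ _) fun p _ _ => hnn p
  have h2 : (#(bigPairs μ u) : ℝ) * u ^ (2 * k) ≤ ∑ p ∈ bigPairs μ u, bil μ p.1 p.2 ^ (2 * k) := by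
    rw [← nsmul_eq_mul, ← sum_const]
    refine sum_le_sum fun p hp => ?_
    simp only [bigPairs, mem_filter, mem_univ, true_and] at hp
    exact pow_le_pow_left₀ hu.le hp.le _
  linarith

/-- **Pair tail count, registered form** (sub-goal `triangle_pair_tail` of stmt-PneNP-10680). -/
theorem triangle_pair_tail : ∀ {t : ℕ} (μ : Fin t → Fin t → ℝ) {u : ℝ}, 0 < u → ∀ {k : ℕ}, 1 ≤ k → (#(bigPairs μ u) : ℝ) * u ^ (2 * k) ≤ 4 ^ t * Kk k ^ 2 * (∑ a, ∑ b, μ a b ^ 2) ^ k :=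
  fun μ _ hu _ hk => card_bigPairs_le μ hu hk

end

end Summit.PneNP.PneNP.Theorems.XorDoor.TriLine.Heavy
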